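import Literature.NumberTheory.LFunctions.SemimultiplicativeMoebiusAdditive
import Mathlib.GroupTheory.OrderOfElement
import Mathlib.Analysis.SpecificLimits.Basic
import HarnessLib

/-!
# Konieczny 2020, §7 (structured sequences), II: rationality, uniqueness, stabilisation

Topic `Literature/NumberTheory/LFunctions`. Everything in this file is PROVED. We finish the
multiplicative rendering of Proposition 7.1 / Corollary 7.4 / Remark 7.3 of J. Konieczny,
Monatsh. Math. 192 (2020) (arXiv:1808.06196, §7) and the stabilisation step of §8:

* `window_char` — **Proposition 7.1** on one window: if `‖f(pn) - f(p'n)‖ ≤ ρ` for all `n`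
  supported in `[A, A+ℓ)`, then there is a `D`-th root of unity `ω` (where `D` is a fixed divisor
  structure of `p - p'` coprime to `q`: `p - p' ∣ D q^{e₀}`) with `‖f(n) - ω^n‖ ≤ C ρ` for all
  `n` supported in the core `[A + κ + e₀, A + ℓ - κ - 2)`.  (Paper: `‖φ(n) - αn‖ ≪ ε s_q(n)` with
  `α = a/b`, `b ∣ p - p'` coprime to `q`; our `ω = e(α)`.)  The rational `α` is obtained by
  snapping the real character `w` of `approx_char` to an exact root of unity (the paper's
  "rationality of `α`" and "denominator coprime to `q`" paragraphs).
* `roots_eq_of_near` — **Remark 7.3** (uniqueness): two `D`-th roots of unity that nearly agree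
  at some `q^j` are equal (`D` coprime to `q`).
* `structured` — the §8 consequence used for Theorem 2: if the local deviations
  `∑_{m<q^ℓ} ‖f(p m q^K) - f(p' m q^K)‖` tend to `0`, then ONE root of unity `ω` approximates
  `f` on all far windows: `‖f(m q^k) - ω^{m q^k}‖ ≤ C · (deviation at K = k - s₀)` for `m < q^{2r}`.
-/

noncomputable section

open Finset Filter
open scoped ComplexConjugate Topology

namespace Literature.NumberTheory.LFunctions

namespace Konieczny

/-! ## Arithmetic of the denominator -/

/-- Every `N₀ ≥ 1` divides `D q^e` for some `D ≥ 1` coprime to `q` (split off the `q`-smooth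
part). [folklore] -/
theorem exists_coprime_factor (q : ℕ) :
    ∀ N₀ : ℕ, 0 < N₀ → ∃ D e : ℕ, 0 < D ∧ Nat.Coprime D q ∧ N₀ ∣ D * q ^ e := by
  intro N₀
  induction N₀ using Nat.strong_induction_on with
  | _ N₀ ih =>
      intro hN
      by_cases hc : Nat.Coprime N₀ q
      · exact ⟨N₀, 0, hN, hc, by simp⟩
      · set g := Nat.gcd N₀ q with hg
        have hg0 : 0 < g := Nat.gcd_pos_of_pos_left q hN
        have hg1 : g ≠ 1 := hc
        obtain ⟨N₁, hN₁⟩ : g ∣ N₀ := Nat.gcd_dvd_left N₀ q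
        have hgq : g ∣ q := Nat.gcd_dvd_right N₀ q
        have hN₁pos : 0 < N₁ := by
          rcases Nat.eq_zero_or_pos N₁ with h | h
          · rw [h, mul_zero] at hN₁; omega
          · exact h
        have hN₁lt : N₁ < N₀ := by
          rw [hN₁]
          have : 2 ≤ g := by omega
          nlinarith
        obtain ⟨D, e, hD, hDq, hdvd⟩ := ih N₁ hN₁lt hN₁pos
        refine ⟨D, e + 1, hD, hDq, ?_⟩
        calc N₀ = g * N₁ := hN₁
          _ ∣ g * (D * q ^ e) := mul_dvd_mul_left g hdvd
          _ ∣ q * (D * q ^ e) := mul_dvd_mul_right hgq _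
          _ = D * q ^ (e + 1) := by ring

/-- **Transfer of roots of unity through `×q^s`**: if `Ω^D = 1` with `D` coprime to `q` then
`Ω = ω^{q^s}` for some `ω` with `ω^D = 1`. [folklore] -/
theorem exists_root_transfer {q D : ℕ} (hD : 0 < D) (hDq : Nat.Coprime D q) {Ω : ℂ}
    (hΩ : Ω ^ D = 1) (s : ℕ) : ∃ ω : ℂ, ω ^ D = 1 ∧ ω ^ q ^ s = Ω := by
  rcases Nat.eq_or_lt_of_le hD with h1 | h1
  · -- `D = 1`
    refine ⟨1, one_pow _, ?_⟩
    rw [← h1, pow_one] at hΩ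
    rw [hΩ, one_pow]
  · have hcop : Nat.Coprime (q ^ s) D := (hDq.symm).pow_left s
    obtain ⟨u, -, hu⟩ := Nat.exists_mul_mod_eq_one_of_coprime hcop h1
    refine ⟨Ω ^ u, by rw [← pow_mul, mul_comm, pow_mul, hΩ, one_pow], ?_⟩
    have hdec : u * q ^ s = D * (q ^ s * u / D) + 1 := by
      have := Nat.div_add_mod (q ^ s * u) D
      rw [hu] at this
      rw [mul_comm u]; exact this.symm
    rw [← pow_mul, hdec, pow_add, pow_mul, hΩ, one_pow, one_mul, pow_one]

/-- **Konieczny 2020, Remark 7.3 (uniqueness), multiplicative form**: if `ω₁^D = ω₂^D = 1` with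
`D` coprime to `q` and `‖ω₁^{q^j} - ω₂^{q^j}‖ < 4/D` for some `j`, then `ω₁ = ω₂`.
[cite: Konieczny2020, Remark 7.3] -/
theorem roots_eq_of_near {q D : ℕ} (hD : 0 < D) (hDq : Nat.Coprime D q) {ω₁ ω₂ : ℂ}
    (h₁ : ω₁ ^ D = 1) (h₂ : ω₂ ^ D = 1) {j : ℕ}
    (hnear : ‖ω₁ ^ q ^ j - ω₂ ^ q ^ j‖ < 4 / D) : ω₁ = ω₂ := by
  have hω₂0 : ω₂ ≠ 0 := by
    rintro rfl
    rw [zero_pow hD.ne'] at h₂; exact zero_ne_one h₂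
  have hω₂n : ‖ω₂‖ = 1 := by
    have h : ‖ω₂‖ ^ D = 1 := by rw [← norm_pow, h₂, norm_one]
    exact (pow_eq_one_iff_of_nonneg (norm_nonneg _) hD.ne').1 h
  set η := ω₁ / ω₂ with hη
  have hηD : η ^ D = 1 := by rw [hη, div_pow, h₁, h₂, div_one]
  have hηj : ‖η ^ q ^ j - 1‖ < 4 / D := by
    have : η ^ q ^ j - 1 = (ω₁ ^ q ^ j - ω₂ ^ q ^ j) / ω₂ ^ q ^ j := by
      rw [hη, div_pow, sub_div, div_self (pow_ne_zero _ hω₂0)]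
    rw [this, norm_div, norm_pow, hω₂n, one_pow, div_one]
    exact hnear
  -- `η^{q^j}` is a `D`-th root of unity within `4/D` of `1`, hence equal to `1`
  have hηj1 : η ^ q ^ j = 1 := by
    by_contra hne
    have hpow : (η ^ q ^ j) ^ D = 1 := by rw [← pow_mul, mul_comm, pow_mul, hηD, one_pow]
    have := norm_sub_one_ge_of_pow_eq_one hD hpow hne
    linarith
  -- the order of `η` divides `q^j` and `D`, coprime, so `η = 1`
  have ho1 : orderOf η ∣ q ^ j := orderOf_dvd_of_pow_eq_one hηj1
  have ho2 : orderOf η ∣ D := orderOf_dvd_of_pow_eq_one hηD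
  have hco : Nat.Coprime (orderOf η) D := Nat.Coprime.coprime_dvd_left ho1 ((hDq.symm).pow_left j)
  have hord : orderOf η = 1 := Nat.Coprime.eq_one_of_dvd hco ho2
  rw [orderOf_eq_one_iff] at hord
  rw [hη, div_eq_one_iff_eq hω₂0] at hord
  exact hord

/-! ## Proposition 7.1 on one window -/

/-- **Konieczny 2020, Proposition 7.1 + Corollary 7.4 on one window, multiplicative form.**
Setting as in `approx_mul` (`f` unimodular `q`-semimultiplicative with gap `≤ r`, `p' < p`,
`p` coprime to `q`, `p < q^B`, `q^{B+r} p'^t < p^t`, `κ = r + tB`), plus: `D ≥ 1` coprime to `q`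
and `e₀` with `p - p' ∣ D q^{e₀}`, and a window length `ℓ ≥ 2κ + B + 2`.  If
`‖f(pn) - f(p'n)‖ ≤ ρ` for all `n` supported in `[A, A+ℓ)`, then there is `ω` with `ω^D = 1` and
`‖f(n) - ω^n‖ ≤ (18 t q² ℓ + 2 q^ℓ (1 + 36 t q² ℓ)) ρ` for all `n` supported in
`[A + κ + e₀, A + ℓ - κ - 2)`. [cite: Konieczny2020, Proposition 7.1] -/
theorem window_char {q r : ℕ} (hq : 2 ≤ q) {f : ℕ → ℂ} (hf : IsSemimultiplicative q r f)
    (hf1 : ∀ n, ‖f n‖ = 1) {p p' t B A ℓ D e₀ : ℕ} (hp'p : p' < p) (hp'0 : 0 < p')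
    (hcop : Nat.Coprime q p) (hB : p < q ^ B) (ht0 : 0 < t) (ht : q ^ (B + r) * p' ^ t < p ^ t)
    (hD : 0 < D) (hDq : Nat.Coprime D q) (hN₀ : (p - p') ∣ D * q ^ e₀)
    (hℓ : 2 * (r + t * B) + B + 2 ≤ ℓ) {ρ : ℝ} (hρ : 0 ≤ ρ)
    (Hρ : ∀ n, q ^ A ∣ n → n < q ^ (A + ℓ) → ‖f (p * n) - f (p' * n)‖ ≤ ρ) :
    ∃ ω : ℂ, ω ^ D = 1 ∧ ∀ n : ℕ, q ^ (A + (r + t * B) + e₀) ∣ n →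
      n < q ^ (A + ℓ - (r + t * B) - 2) →
        ‖f n - ω ^ n‖ ≤ (18 * t * q ^ 2 * ℓ + 2 * q ^ ℓ * (1 + 36 * t * q ^ 2 * ℓ)) * ρ := by
  have hqpos : 0 < q := by omega
  have hq0 : (0 : ℝ) < q := by exact_mod_cast hqpos
  have hq1 : (1 : ℝ) ≤ q := by exact_mod_cast hqpos
  set κ := r + t * B with hκ
  have hℓ' : 2 * κ ≤ ℓ := by omega
  set l₀ := A + κ with hl₀
  set l₁ := A + ℓ - κ - 2 with hl₁
  have hl₀l₁ : l₀ ≤ l₁ := by omega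
  have hl₁eq : l₁ + 2 = A + ℓ - κ := by omega
  -- Step 2–3: the character `w` from shadowing
  set θ : ℕ → ℂ := fun l => f (q ^ l) with hθ
  have hstep : ∀ l, l₀ ≤ l → l < l₁ → ‖θ (l + 1) - θ l ^ q‖ ≤ 3 * t * ρ * q := by
    intro l hl hl'
    have h := approx_pow hq hf hf1 hp'p hp'0 hcop hB ht0 ht Hρ hℓ' (l := l) hl (by omega) q le_rfl
    simpa only [hθ, ← pow_succ'] using h
  obtain ⟨w, hw, hwl⟩ := shadowing hq θ (fun l => hf1 _) (by positivity) l₀ l₁ hl₀l₁ hstep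
  have hwθ : ∀ l, A + (r + t * B) ≤ l → l + 2 ≤ A + ℓ - (r + t * B) →
      ‖f (q ^ l) - w ^ q ^ l‖ ≤ 12 * t * q * ρ := by
    intro l hl hl2
    have := hwl l hl (by omega)
    simp only [hθ] at this
    linarith
  -- Step 4: `f ≈ w^n` on the core `[l₀, l₁)`
  have hcore : ∀ n, q ^ l₀ ∣ n → n < q ^ l₁ → ‖f n - w ^ n‖ ≤ 18 * t * q ^ 2 * ℓ * ρ := by
    intro n hn hnlt
    have h := approx_char hq hf hf1 hp'p hp'0 hcop hB ht0 ht hρ Hρ hℓ' hw hwθ (l₁ - l₀) l₀ n le_rfl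
      (by omega) hn (by rwa [Nat.add_sub_cancel' hl₀l₁])
    refine h.trans ?_
    have : ((l₁ - l₀ : ℕ) : ℝ) ≤ ℓ := by
      have : l₁ - l₀ ≤ ℓ := by omega
      exact_mod_cast this
    have h0 : (0 : ℝ) ≤ 18 * t * q ^ 2 * ρ := by positivity
    nlinarith
  set ρ₃ : ℝ := 18 * t * q ^ 2 * ℓ * ρ with hρ₃
  have hρ₃0 : 0 ≤ ρ₃ := by positivity
  -- Step 5: snapping `w` to a root of unity
  set N₀ := p - p' with hN₀def
  have hN₀pos : 0 < N₀ := by omega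
  have hpeq : p = p' + N₀ := by omega
  have hpl₀ : p * q ^ l₀ < q ^ l₁ := by
    calc p * q ^ l₀ < q ^ B * q ^ l₀ := Nat.mul_lt_mul_of_pos_right hB (pow_pos hqpos _)
      _ = q ^ (l₀ + B) := by rw [← pow_add, add_comm]
      _ ≤ q ^ l₁ := Nat.pow_le_pow_right hqpos (by omega)
  have hp'l₀ : p' * q ^ l₀ < q ^ l₁ :=
    lt_of_le_of_lt (Nat.mul_le_mul_right _ hp'p.le) hpl₀
  set u : ℂ := w ^ (N₀ * q ^ l₀) with hu
  have hu1 : ‖u‖ = 1 := by rw [hu, norm_pow, hw, one_pow]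
  have hudiff : w ^ (p * q ^ l₀) - w ^ (p' * q ^ l₀) = w ^ (p' * q ^ l₀) * (u - 1) := by
    rw [hu, hpeq, add_mul, pow_add]; ring
  have hunear : ‖u - 1‖ ≤ ρ + 2 * ρ₃ := by
    have h1 := hcore (p * q ^ l₀) (dvd_mul_left _ _) hpl₀
    have h2 := hcore (p' * q ^ l₀) (dvd_mul_left _ _) hp'l₀
    have h3 := Hρ (q ^ l₀) (pow_dvd_pow q (by omega)) (Nat.pow_lt_pow_right (by omega) (by omega))
    have : ‖u - 1‖ = ‖w ^ (p * q ^ l₀) - w ^ (p' * q ^ l₀)‖ := by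
      rw [hudiff, norm_mul, norm_pow, hw, one_pow, one_mul]
    rw [this]
    calc ‖w ^ (p * q ^ l₀) - w ^ (p' * q ^ l₀)‖
        ≤ ‖w ^ (p * q ^ l₀) - f (p * q ^ l₀)‖ + ‖f (p * q ^ l₀) - w ^ (p' * q ^ l₀)‖ :=
          norm_sub_le_norm_sub_add_norm_sub _ _ _
      _ ≤ ‖w ^ (p * q ^ l₀) - f (p * q ^ l₀)‖ +
          (‖f (p * q ^ l₀) - f (p' * q ^ l₀)‖ + ‖f (p' * q ^ l₀) - w ^ (p' * q ^ l₀)‖) :=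
          add_le_add le_rfl (norm_sub_le_norm_sub_add_norm_sub _ _ _)
      _ ≤ ρ₃ + (ρ + ρ₃) := by
          refine add_le_add ?_ (add_le_add h3 h2)
          rw [norm_sub_rev]; exact h1
      _ = ρ + 2 * ρ₃ := by ring
  -- the small root `ξ` of `conj u`
  have hN : 0 < N₀ * q ^ l₀ := Nat.mul_pos hN₀pos (pow_pos hqpos _)
  have hcu1 : ‖conj u‖ = 1 := by rw [Complex.norm_conj, hu1]
  obtain ⟨ξ, hξ1, hξN, hξnear⟩ := exists_small_root hcu1 hN
  have hξsmall : ‖ξ - 1‖ ≤ 2 * (ρ + 2 * ρ₃) / (q : ℝ) ^ l₀ := by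
    refine hξnear.trans ?_
    have hcu : ‖conj u - 1‖ = ‖u - 1‖ := by
      rw [← Complex.norm_conj (u - 1), map_sub, map_one]
    rw [hcu]
    have hNr : (1 : ℝ) ≤ N₀ := by exact_mod_cast hN₀pos
    have hql₀ : (0 : ℝ) < (q : ℝ) ^ l₀ := by positivity
    calc Real.pi / 2 / ((N₀ * q ^ l₀ : ℕ) : ℝ) * ‖u - 1‖
        ≤ 2 / (q : ℝ) ^ l₀ * (ρ + 2 * ρ₃) := by
          refine mul_le_mul ?_ hunear (norm_nonneg _) (by positivity)
          push_cast
          rw [div_le_div_iff₀ (by positivity) hql₀]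
          nlinarith [Real.pi_lt_four, Real.pi_pos]
      _ = 2 * (ρ + 2 * ρ₃) / (q : ℝ) ^ l₀ := by ring
  set w' := w * ξ with hw'
  have hw'1 : ‖w'‖ = 1 := by rw [hw', norm_mul, hw, hξ1, one_mul]
  have hw'N : w' ^ (N₀ * q ^ l₀) = 1 := by
    rw [hw', mul_pow, ← hu, hξN, Complex.mul_conj, Complex.normSq_eq_norm_sq, hu1]; simp
  have hww' : ∀ n, n < q ^ l₁ → ‖w ^ n - w' ^ n‖ ≤ 2 * (q : ℝ) ^ ℓ * (ρ + 2 * ρ₃) := by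
    intro n hn
    have h1 : ‖w ^ n - w' ^ n‖ = ‖ξ ^ n - 1‖ := by
      rw [hw', mul_pow, show w ^ n - w ^ n * ξ ^ n = -(w ^ n * (ξ ^ n - 1)) by ring,
        norm_neg, norm_mul, norm_pow, hw, one_pow, one_mul]
    rw [h1]
    have h2 := norm_pow_sub_pow_le hξ1.le (le_of_eq norm_one) n
    rw [one_pow] at h2
    refine h2.trans ?_
    have hnr : (n : ℝ) ≤ (q : ℝ) ^ l₁ := by exact_mod_cast hn.le
    have hl₁ℓ : (q : ℝ) ^ l₁ ≤ (q : ℝ) ^ l₀ * (q : ℝ) ^ ℓ := by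
      rw [← pow_add]; exact pow_le_pow_right₀ hq1 (by omega)
    have hql₀ : (0 : ℝ) < (q : ℝ) ^ l₀ := by positivity
    calc (n : ℝ) * ‖ξ - 1‖ ≤ ((q : ℝ) ^ l₀ * (q : ℝ) ^ ℓ) * (2 * (ρ + 2 * ρ₃) / (q : ℝ) ^ l₀) :=
          mul_le_mul (hnr.trans hl₁ℓ) hξsmall (norm_nonneg _) (by positivity)
      _ = 2 * (q : ℝ) ^ ℓ * (ρ + 2 * ρ₃) := by field_simp
  -- the root of unity
  set Ω := w' ^ q ^ (l₀ + e₀) with hΩ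
  have hΩD : Ω ^ D = 1 := by
    obtain ⟨c, hc⟩ : N₀ * q ^ l₀ ∣ q ^ (l₀ + e₀) * D := by
      rw [show q ^ (l₀ + e₀) * D = (D * q ^ e₀) * q ^ l₀ by ring]
      exact mul_dvd_mul hN₀ (dvd_refl _)
    rw [hΩ, ← pow_mul, hc, pow_mul, hw'N, one_pow]
  obtain ⟨ω, hωD, hωΩ⟩ := exists_root_transfer hD hDq hΩD (l₀ + e₀)
  refine ⟨ω, hωD, fun n hn hnlt => ?_⟩
  have hnlt' : n < q ^ l₁ := by rw [hl₁]; exact hnlt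
  obtain ⟨n', rfl⟩ := hn
  have hωn : ω ^ (q ^ (A + (r + t * B) + e₀) * n') = w' ^ (q ^ (A + (r + t * B) + e₀) * n') := by
    rw [pow_mul, pow_mul, show A + (r + t * B) + e₀ = l₀ + e₀ by rw [hl₀], hωΩ, hΩ]
  rw [hωn]
  have hdvd₀ : q ^ l₀ ∣ q ^ (A + (r + t * B) + e₀) * n' :=
    dvd_mul_of_dvd_left (pow_dvd_pow q (by omega)) _
  calc ‖f (q ^ (A + (r + t * B) + e₀) * n') - w' ^ (q ^ (A + (r + t * B) + e₀) * n')‖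
      ≤ ‖f (q ^ (A + (r + t * B) + e₀) * n') - w ^ (q ^ (A + (r + t * B) + e₀) * n')‖ +
        ‖w ^ (q ^ (A + (r + t * B) + e₀) * n') - w' ^ (q ^ (A + (r + t * B) + e₀) * n')‖ :=
        norm_sub_le_norm_sub_add_norm_sub _ _ _
    _ ≤ ρ₃ + 2 * (q : ℝ) ^ ℓ * (ρ + 2 * ρ₃) := add_le_add (hcore _ hdvd₀ hnlt') (hww' _ hnlt')
    _ = (18 * t * q ^ 2 * ℓ + 2 * q ^ ℓ * (1 + 36 * t * q ^ 2 * ℓ)) * ρ := by rw [hρ₃]; ring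

/-! ## Stabilisation (§8) -/

/-- **Konieczny 2020, §8 (the structured branch), multiplicative form.**  Let `f` be unimodular
and `q`-semimultiplicative with gap `≤ r` (`r ≥ 1`), and let `p' < p` be positive with `p` coprime
to `q`.  There are `ℓ, s₀, D ≥ 1` and `C ≥ 0` (depending only on `q, r, p, p'`) such that: if the
local deviations `∑_{m<q^ℓ} ‖f(p m q^K) - f(p' m q^K)‖` tend to `0` as `K → ∞`, then there is a
`D`-th root of unity `ω` and `k₁ ≥ s₀` with
`‖f(m q^k) - ω^{m q^k}‖ ≤ C ∑_{m'<q^ℓ} ‖f(p m' q^{k-s₀}) - f(p' m' q^{k-s₀})‖`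
for all `k ≥ k₁` and `m < q^{2r}`.  (Paper: `α_{l,k} = α` for `k` large, by finiteness of the set of
possible `α` and Remark 7.3; then (70:02)/Corollary 7.4.) [cite: Konieczny2020, Section 8] -/
theorem structured {q r : ℕ} (hq : 2 ≤ q) (hr : 1 ≤ r) {f : ℕ → ℂ} (hf : IsSemimultiplicative q r f)
    (hf1 : ∀ n, ‖f n‖ = 1) {p p' : ℕ} (hp'p : p' < p) (hp'0 : 0 < p') (hcop : Nat.Coprime q p) :
    ∃ ℓ s₀ D : ℕ, 0 < D ∧ ∃ C : ℝ, 0 ≤ C ∧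
      (Tendsto (fun K : ℕ => ∑ m ∈ range (q ^ ℓ), ‖f (p * (m * q ^ K)) - f (p' * (m * q ^ K))‖)
          atTop (𝓝 0) →
        ∃ (ω : ℂ) (k₁ : ℕ), ω ^ D = 1 ∧ s₀ ≤ k₁ ∧ ∀ k, k₁ ≤ k → ∀ m, m < q ^ (2 * r) →
          ‖f (m * q ^ k) - ω ^ (m * q ^ k)‖ ≤
            C * ∑ m' ∈ range (q ^ ℓ), ‖f (p * (m' * q ^ (k - s₀))) - f (p' * (m' * q ^ (k - s₀)))‖) := by
  have hqpos : 0 < q := by omega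
  have hq1 : 1 < q := by omega
  have hp1 : 1 < p := by omega
  -- the constants `B, t, D, e₀, κ, ℓ, s₀, C`
  set B := p with hBdef
  have hB : p < q ^ B := Nat.lt_pow_self hq1
  obtain ⟨t, ht⟩ : ∃ t : ℕ, q ^ (B + r) * p' ^ t < p ^ t := by
    have hratio : (p' : ℝ) / p < 1 := by
      rw [div_lt_one (by exact_mod_cast (by omega : 0 < p))]; exact_mod_cast hp'p
    obtain ⟨t, ht⟩ := exists_pow_lt_of_lt_one (show (0 : ℝ) < 1 / (q : ℝ) ^ (B + r) by positivity) hratio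
    refine ⟨t, ?_⟩
    have hpt : (0 : ℝ) < (p : ℝ) ^ t := by positivity
    have hqBr : (0 : ℝ) < (q : ℝ) ^ (B + r) := by positivity
    rw [div_pow, div_lt_div_iff₀ hpt hqBr, one_mul, mul_comm] at ht
    exact_mod_cast ht
  have ht0 : 0 < t := by
    rcases Nat.eq_zero_or_pos t with h | h
    · subst h; simp at ht
      have : 1 ≤ q ^ (B + r) := pow_pos hqpos _
      omega
    · exact h
  obtain ⟨D, e₀, hD, hDq, hN₀⟩ := exists_coprime_factor q (p - p') (by omega)
  set κ := r + t * B with hκ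
  set ℓ := 2 * κ + B + 2 + e₀ + 2 * r + 1 with hℓdef
  set s₀ := κ + e₀ with hs₀
  set C : ℝ := 18 * t * q ^ 2 * ℓ + 2 * q ^ ℓ * (1 + 36 * t * q ^ 2 * ℓ) with hC
  have hC0 : 0 ≤ C := by positivity
  refine ⟨ℓ, s₀, D, hD, C, hC0, fun hdev => ?_⟩
  -- the deviation at scale `K`
  set dev : ℕ → ℝ := fun K => ∑ m ∈ range (q ^ ℓ), ‖f (p * (m * q ^ K)) - f (p' * (m * q ^ K))‖
    with hdevdef
  have hdev0 : ∀ K, 0 ≤ dev K := fun K => sum_nonneg fun m _ => norm_nonneg _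
  have Hρ : ∀ K n, q ^ K ∣ n → n < q ^ (K + ℓ) → ‖f (p * n) - f (p' * n)‖ ≤ dev K := by
    intro K n hn hnlt
    obtain ⟨m, rfl⟩ := hn
    have hm : m < q ^ ℓ := by
      rw [pow_add] at hnlt
      exact lt_of_mul_lt_mul_left hnlt (Nat.zero_le _)
    rw [mul_comm (q ^ K) m]
    exact single_le_sum (f := fun m => ‖f (p * (m * q ^ K)) - f (p' * (m * q ^ K))‖)
      (fun m _ => norm_nonneg _) (mem_range.2 hm)
  -- the window theorem at each scale `K`
  have hℓ : 2 * (r + t * B) + B + 2 ≤ ℓ := by omega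
  have hwin : ∀ K, ∃ ω : ℂ, ω ^ D = 1 ∧ ∀ n : ℕ, q ^ (K + (r + t * B) + e₀) ∣ n →
      n < q ^ (K + ℓ - (r + t * B) - 2) → ‖f n - ω ^ n‖ ≤ C * dev K :=
    fun K => window_char hq hf hf1 hp'p hp'0 hcop hB ht0 ht hD hDq hN₀ hℓ (hdev0 K) (Hρ K)
  choose ωK hωKD hωK using hwin
  have hrange : ∀ K, K + ℓ - (r + t * B) - 2 = (K + s₀) + (2 * r + B + 1) := by
    intro K; omega
  -- the threshold
  have hDr : (0 : ℝ) < D := by exact_mod_cast hD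
  have hev : ∀ᶠ K : ℕ in atTop, C * dev K < 2 / D := by
    have h := hdev.const_mul C
    rw [mul_zero] at h
    exact h.eventually (gt_mem_nhds (by positivity))
  obtain ⟨K₁, hK₁⟩ := eventually_atTop.1 hev
  -- consecutive roots agree beyond `K₁`
  have hagree : ∀ K, K₁ ≤ K → ωK K = ωK (K + 1) := by
    intro K hK
    have h1 := hωK K (q ^ (K + s₀ + 1)) (pow_dvd_pow q (by omega))
      (by rw [hrange]; exact Nat.pow_lt_pow_right hq1 (by omega))
    have h2 := hωK (K + 1) (q ^ (K + s₀ + 1)) (pow_dvd_pow q (by omega))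
      (by rw [hrange]; exact Nat.pow_lt_pow_right hq1 (by omega))
    refine roots_eq_of_near hD hDq (hωKD K) (hωKD (K + 1)) (j := K + s₀ + 1) ?_
    calc ‖ωK K ^ q ^ (K + s₀ + 1) - ωK (K + 1) ^ q ^ (K + s₀ + 1)‖
        ≤ ‖ωK K ^ q ^ (K + s₀ + 1) - f (q ^ (K + s₀ + 1))‖ +
          ‖f (q ^ (K + s₀ + 1)) - ωK (K + 1) ^ q ^ (K + s₀ + 1)‖ := norm_sub_le_norm_sub_add_norm_sub _ _ _
      _ < 2 / D + 2 / D := by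
          refine add_lt_add ?_ ?_
          · rw [norm_sub_rev]; exact h1.trans_lt (hK₁ K hK)
          · exact h2.trans_lt (hK₁ (K + 1) (by omega))
      _ = 4 / D := by ring
  have hconst : ∀ K, K₁ ≤ K → ωK K = ωK K₁ := by
    intro K hK
    induction K with
    | zero => have : K₁ = 0 := by omega
              subst this; rfl
    | succ K ih =>
        rcases Nat.eq_or_lt_of_le hK with h | h
        · rw [h]
        · rw [← hagree K (by omega), ih (by omega)]
  -- conclusion
  refine ⟨ωK K₁, K₁ + s₀, hωKD K₁, by omega, fun k hk m hm => ?_⟩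
  obtain ⟨K, rfl⟩ : ∃ K, k = K + s₀ := ⟨k - s₀, by omega⟩
  have hKK₁ : K₁ ≤ K := by omega
  rw [Nat.add_sub_cancel, ← hconst K hKK₁]
  refine hωK K (m * q ^ (K + s₀)) (dvd_mul_of_dvd_right (pow_dvd_pow q (by omega)) m) ?_
  rw [hrange]
  calc m * q ^ (K + s₀) < q ^ (2 * r) * q ^ (K + s₀) := Nat.mul_lt_mul_of_pos_right hm (pow_pos hqpos _)
    _ ≤ q ^ (2 * r + B + 1) * q ^ (K + s₀) :=
        Nat.mul_le_mul_right _ (Nat.pow_le_pow_right hqpos (by omega))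
    _ = q ^ (K + s₀ + (2 * r + B + 1)) := by rw [← pow_add, add_comm]

end Konieczny

end Literature.NumberTheory.LFunctions
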